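import Literature.Geometry.Kaehler.SiegelTorusThetaCharacteristicModTwo
import Literature.LinearAlgebra.Matrix.CardSymplecticGroup
import HarnessLib

/-!
# `[Γ_g : Γ_g(2)] = |Sp_{2g}(𝔽₂)| = 2^{g²} ∏_{i=1}^{g} (2^{2i} - 1)` — the index of the principal congruence
# subgroup of level `2` in the Siegel modular group

F. Dalla Piazza, B. van Geemen, *Siegel modular forms and finite symplectic groups* (2009) [arXiv:0804.3769], §1.2–1.3
(held text `paper:arxiv-0804.3769`, p0004 L33–L39 and L57–L58), verbatim:
> the order of `Sp(2g)` is `|Sp(2g)| = 2^{2g-1}(2^{2g}-1)|Sp(2g-2)| = 2^{2g-1}(2^{2g}-1)2^{2g-3}(2^{2g-2}-1) ⋯ 2(2²-1)`.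
> In particular, `|Sp(2g)| = 6, 6! = 720, 36·(8!)` for `g = 1, 2, 3`. … The group `Γ_g` acts on `V = 𝔽₂^{2g}`,
> and thus on the characteristics, through its quotient `Sp(2g) = Γ_g/Γ_g(2)`.

Lane `lit-hodgefound`, prover seat p25, row g33-#7. THEOREMS ONLY (no definition, no named fact): the junction of
two tree results — `[Γ_g : Γ_g(2)] = |Sp_{2g}(ℤ/2)|` (`Geometry/Kaehler/SiegelTorusThetaCharacteristicModTwo`:
`index_ker_symplecticCharAction`, `ker_symplecticCharAction_eq_ker_reduceModTwo`, from the surjectivity of the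
reduction `Sp_{2g}(ℤ) → Sp_{2g}(ℤ/2)`) and Artin's order of the finite symplectic group
(`LinearAlgebra/Matrix/CardSymplecticGroup`: `natCard_symplecticGroup_eq`) — giving the printed index formula for
the tree's `Γ_g(2) = ker (reduceModTwo g)`:

* **`index_ker_reduceModTwo`** — `[Γ_g : Γ_g(2)] = 2^{g²} ∏_{i=1}^{g} (2^{2i} - 1)`;
* `index_ker_reduceModTwo_succ` — the printed recursion `[Γ_{g+1} : Γ_{g+1}(2)] = 2^{2g+1}(2^{2g+2} - 1)[Γ_g : Γ_g(2)]`;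
* `index_ker_reduceModTwo_fin_three` — `[Γ_3 : Γ_3(2)] = 1451520 = 36 · 8!` (the values `6` and `720` for
  `g = 1, 2` are the tree's `index_ker_reduceModTwo_one`, `index_ker_reduceModTwo_two`, obtained through `S_3`, `S_6`
  in `SiegelThetaCharacteristicEvenActionSymmetricThree`, `…OddActionSymmetricSix`; they also follow from
  `index_ker_reduceModTwo` by `decide`).

## References

* [DallaPiazzaVanGeemen2009] F. Dalla Piazza, B. van Geemen, Adv. Theor. Math. Phys. 13 (2009), arXiv:0804.3769,
  §1.2–1.3 (p0004 of the held text).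
* [Artin1988] E. Artin, *Geometric Algebra*, Chap. III §6 (the order of `Sp_n(𝐅_q)`; the tree's
  `CardSymplecticGroup`).
-/

noncomputable section

namespace Literature.NumberTheory.ModularForms

open Literature.Geometry.Kaehler.ComplexTorus (index_ker_symplecticCharAction ker_symplecticCharAction_eq_ker_reduceModTwo)
open Literature.LinearAlgebra.Matrix.CardSymplecticGroup (natCard_symplecticGroup_eq natCard_symplecticGroup_fin_succ)

/-- **`[Γ_g : Γ_g(2)] = |Sp_{2g}(ℤ/2)|`** for the tree's reduction map `reduceModTwo g : Sp_{2g}(ℤ) →* Sp_{2g}(ℤ/2)`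
("through its quotient `Sp(2g) = Γ_g/Γ_g(2)`"). [cite: DallaPiazzaVanGeemen2009, §1.3 (p0004 L57–L58 of the held text)] -/
theorem index_ker_reduceModTwo_eq_natCard (g : ℕ) :
    (reduceModTwo g).ker.index = Nat.card (Matrix.symplecticGroup (Fin g) (ZMod 2)) := by
  rw [← ker_symplecticCharAction_eq_ker_reduceModTwo, index_ker_symplecticCharAction]

/-- **`[Γ_g : Γ_g(2)] = 2^{g²} ∏_{i=1}^{g} (2^{2i} - 1)`** (`= |Sp_{2g}(𝔽₂)|`, Artin's order formula at `q = 2`).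
[cite: DallaPiazzaVanGeemen2009, §1.2 (p0004 L33–L39 of the held text)] [cite: Artin1988, Chap. III §6] -/
theorem index_ker_reduceModTwo (g : ℕ) :
    (reduceModTwo g).ker.index = 2 ^ (g ^ 2) * ∏ i ∈ Finset.range g, (2 ^ (2 * (i + 1)) - 1) := by
  rw [index_ker_reduceModTwo_eq_natCard, natCard_symplecticGroup_eq, ZMod.card, Fintype.card_fin]

/-- **The printed recursion**: `[Γ_{g+1} : Γ_{g+1}(2)] = 2^{2g+1} (2^{2g+2} - 1) · [Γ_g : Γ_g(2)]`
("`|Sp(2g)| = 2^{2g-1}(2^{2g}-1)|Sp(2g-2)|`"). [cite: DallaPiazzaVanGeemen2009, §1.2 (p0004 L33–L35 of the held text)] -/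
theorem index_ker_reduceModTwo_succ (g : ℕ) :
    (reduceModTwo (g + 1)).ker.index = 2 ^ (2 * g + 1) * (2 ^ (2 * (g + 1)) - 1) * (reduceModTwo g).ker.index := by
  rw [index_ker_reduceModTwo_eq_natCard, index_ker_reduceModTwo_eq_natCard, natCard_symplecticGroup_fin_succ,
    ZMod.card]

/-- `[Γ_3 : Γ_3(2)] = 1451520 = 36 · 8!` ("`|Sp(6)| = 36·(8!)`").
[cite: DallaPiazzaVanGeemen2009, §1.2 (p0004 L39 of the held text)] -/
theorem index_ker_reduceModTwo_fin_three : (reduceModTwo 3).ker.index = 36 * Nat.factorial 8 := by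
  rw [index_ker_reduceModTwo]
  decide

end Literature.NumberTheory.ModularForms

end
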